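import Literature.NumberTheory.LFunctions.ApproxFunctionalEquation
import Literature.NumberTheory.LFunctions.DirichletPolynomialCrudeMVT
import HarnessLib

/-!
# A weighted mean square of `ζ` on the critical line: `∫_{-T}^{T} |ζ(1/2+it)|² dt/(1+|t|) ≪ log³ T`

Topic `Literature/NumberTheory/LFunctions`. Everything in this file is PROVED; there are no
definitions and no named facts.

The classical mean square `∫_0^T |ζ(1/2+it)|² dt ~ T log T` (Hardy–Littlewood 1918; Titchmarsh,
*The Theory of the Riemann Zeta-Function*, Thm. 7.3) is not in Mathlib or in the tree. For the
proof of Balazard–de Roton's Théorème 1 (`NymanBeurlingRateProofs.lean`, their Proposition 14 with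
Titchmarsh's (14.14.1) `ζ(1/2+it) ≪ exp(A log t/log log t)` replaced by an average bound) a
logarithmically lossy upper bound suffices, and this file proves one from two results of the tree:
the approximate functional equation on the critical line in Bourgain's form
`|ζ(1/2+it)| ≤ 2|∑_{n≤√(t/2π)} n^{-1/2+it}| + C` (`Literature.NumberTheory.LFunctions.Bourgain2017_eq43_holds`,
Titchmarsh Thm. 4.13) and the crude two-sided mean value theorem for Dirichlet polynomials
(`Literature.NumberTheory.LFunctions.DirichletMVT.abs_meanSquare_sub_le`, Titchmarsh §7.2). On a
block `2πm² ≤ t ≤ 2π(m+1)²` the length of the sum is `m` or `m+1`, so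
`∫_{2πm²}^{2π(m+1)²} |ζ(1/2+it)|² dt ≪ m log² m` (block length `≍ m`, off-diagonal `≪ m log m`,
`∑_{n≤m} 1/n ≤ 1 + log m`), whence `∫_{2πm²}^{2π(m+1)²} |ζ|² dt/(1+t) ≪ log² m/m` and, summing,
`∫_0^T |ζ(1/2+it)|² dt/(1+t) ≪ log³ T` (one logarithm weaker than what Thm. 7.3 gives, amply
sufficient).

## Main results

* `norm_sq_zeta_half_block_le` — `∫_{2πm²}^{2π(m+1)²} |ζ(1/2+it)|² dt ≤ K (m+1)(1+log(m+1))²`.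
* `exists_integral_norm_sq_zeta_half_div_le` — `∫_0^T |ζ(1/2+it)|²/(1+t) dt ≤ C(1 + log T)³`
  for `T ≥ 1`; `exists_integral_norm_sq_zeta_half_div_le_symm` — the same for
  `∫_{-T}^{T} |ζ(1/2+it)|²/(1+|t|) dt`.

## References

* E. C. Titchmarsh, *The Theory of the Riemann Zeta-Function*, 2nd ed. (1986), Thm. 4.13, §7.2,
  Thm. 7.3.
* G. H. Hardy, J. E. Littlewood, *Contributions to the theory of the Riemann zeta-function and
  the theory of the distribution of primes*, Acta Math. 41 (1918), 119–196.
-/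

noncomputable section

open Complex MeasureTheory Set Filter intervalIntegral Finset
open scoped Real Topology

namespace Literature.NumberTheory.LFunctions

/-! ### The Dirichlet polynomial `∑_{n≤m} n^{-1/2+it}` and its block mean square -/

/-- `‖n^{-1/2}‖² = 1/n` for `n ≥ 1`. [folklore] -/
theorem norm_natCast_cpow_neg_half_sq {n : ℕ} (hn : 1 ≤ n) :
    ‖(n : ℂ) ^ (-(1 / 2 : ℂ))‖ ^ 2 = ((n : ℝ))⁻¹ := by
  have hn0 : (0 : ℝ) < n := by exact_mod_cast hn
  rw [show (-(1 / 2 : ℂ)) = ((-(1 / 2) : ℝ) : ℂ) by push_cast; ring,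
    Complex.norm_natCast_cpow_of_pos (by omega), ← Real.rpow_natCast,
    ← Real.rpow_mul hn0.le]
  norm_num
  rw [Real.rpow_neg_one]

/-- The AFE sum as a Dirichlet polynomial in the shape of the tree's mean value theorem:
`∑_{n≤m} n^{-1/2+it} = ∑_{n≤m} n^{-1/2} · n^{-(-t)i}`. [folklore] -/
theorem afeSum_eq (m : ℕ) (t : ℝ) :
    ∑ n ∈ Finset.Icc 1 m, (n : ℂ) ^ (-(1 / 2 : ℂ) + t * I) =
      ∑ n ∈ Finset.Icc 1 m, (n : ℂ) ^ (-(1 / 2 : ℂ)) * (n : ℂ) ^ (-((((-t : ℝ)) : ℂ) * I)) := by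
  refine Finset.sum_congr rfl fun n hn ↦ ?_
  have hn0 : (n : ℂ) ≠ 0 := by
    have : 1 ≤ n := (Finset.mem_Icc.1 hn).1
    exact_mod_cast (by omega : n ≠ 0)
  rw [← Complex.cpow_add _ _ hn0]
  congr 1
  push_cast
  ring

/-- **Block mean square of the AFE sum**: for `a ≤ b` and `m ≥ 1`,
`∫_a^b |∑_{n≤m} n^{-1/2+it}|² dt ≤ (b − a + 8m(1 + log m))(1 + log m)` (the crude mean value
theorem at `T = −a` and `T = −b`). [cite: Titchmarsh1986, §7.2] -/
theorem integral_norm_sq_afeSum_le {a b : ℝ} (hab : a ≤ b) {m : ℕ} (hm : 1 ≤ m) :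
    ∫ t in a..b, ‖∑ n ∈ Finset.Icc 1 m, (n : ℂ) ^ (-(1 / 2 : ℂ) + t * I)‖ ^ 2 ≤
      (b - a + 8 * m * (1 + Real.log m)) * (1 + Real.log m) := by
  set c : ℕ → ℂ := fun n ↦ (n : ℂ) ^ (-(1 / 2 : ℂ)) with hc
  set D : ℝ → ℝ := fun u ↦ ‖∑ n ∈ Finset.Icc 1 m, c n * (n : ℂ) ^ (-((u : ℂ) * I))‖ ^ 2 with hD
  -- `∑ ‖c n‖² ≤ 1 + log m`
  have hH : ∑ n ∈ Finset.Icc 1 m, ‖c n‖ ^ 2 ≤ 1 + Real.log m := by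
    calc ∑ n ∈ Finset.Icc 1 m, ‖c n‖ ^ 2 = ∑ n ∈ Finset.Icc 1 m, ((n : ℝ))⁻¹ :=
          Finset.sum_congr rfl fun n hn ↦ norm_natCast_cpow_neg_half_sq (Finset.mem_Icc.1 hn).1
      _ ≤ 1 + Real.log m := by
          -- `∑_{n≤m} 1/n ≤ 1 + log m` (Mathlib's `harmonic_le_one_add_log`)
          have h := harmonic_le_one_add_log m
          simp_rw [harmonic_eq_sum_Icc, Rat.cast_sum, Rat.cast_inv, Rat.cast_natCast] at h
          exact h
  have hH0 : 0 ≤ ∑ n ∈ Finset.Icc 1 m, ‖c n‖ ^ 2 := Finset.sum_nonneg fun n _ ↦ sq_nonneg _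
  have hlog : 0 ≤ Real.log m := Real.log_nonneg (by exact_mod_cast hm)
  -- the integrand is `D(−t)`
  have hDt : ∀ t : ℝ, ‖∑ n ∈ Finset.Icc 1 m, (n : ℂ) ^ (-(1 / 2 : ℂ) + t * I)‖ ^ 2 = D (-t) := by
    intro t; rw [hD]; simp only [hc]; rw [afeSum_eq]
  have hDc : Continuous D := by
    rw [hD]
    refine ((continuous_finsetSum _ fun n hn ↦ ?_).norm).pow 2
    have hn0 : (n : ℂ) ≠ 0 := by
      have : 1 ≤ n := (Finset.mem_Icc.1 hn).1
      exact_mod_cast (by omega : n ≠ 0)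
    exact continuous_const.mul (Continuous.const_cpow (by fun_prop) (Or.inl hn0))
  -- change of variables `t ↦ −t`
  have hcv : ∫ t in a..b, ‖∑ n ∈ Finset.Icc 1 m, (n : ℂ) ^ (-(1 / 2 : ℂ) + t * I)‖ ^ 2 =
      (∫ u in (0 : ℝ)..(-a), D u) - ∫ u in (0 : ℝ)..(-b), D u := by
    simp_rw [hDt]
    rw [intervalIntegral.integral_comp_neg (f := D), intervalIntegral.integral_interval_sub_left]
    · exact (hDc.intervalIntegrable (μ := volume) _ _)
    · exact (hDc.intervalIntegrable (μ := volume) _ _)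
  -- the mean value theorem at `−a` and `−b`
  have hMa := DirichletMVT.abs_meanSquare_sub_le c m (-a)
  have hMb := DirichletMVT.abs_meanSquare_sub_le c m (-b)
  rw [hcv]
  have h1 := (abs_le.1 hMa).2
  have h2 := (abs_le.1 hMb).1
  have hE : 4 * (m : ℝ) * (1 + Real.log m) * ∑ n ∈ Finset.Icc 1 m, ‖c n‖ ^ 2 ≤
      4 * m * (1 + Real.log m) * (1 + Real.log m) :=
    mul_le_mul_of_nonneg_left hH (by positivity)
  have hba : 0 ≤ b - a := by linarith
  nlinarith [mul_le_mul_of_nonneg_left hH hba]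

/-! ### `|ζ(1/2+it)|²` on the blocks `2πm² ≤ t ≤ 2π(m+1)²` -/

set_option maxHeartbeats 400000 in
/-- **`∫_{2πm²}^{2π(m+1)²} |ζ(1/2+it)|² dt ≪ (m+1)(1+log(m+1))²`**: there are `K` and `m₀ ≥ 1`
such that this holds with the constant `K` for all `m ≥ m₀` (AFE in Bourgain's form (4.3): on the
block the AFE sum has length `m` or `m + 1`; block mean square). [cite: Titchmarsh1986, Thm. 4.13 and §7.2] -/
theorem norm_sq_zeta_half_block_le :
    ∃ K : ℝ, ∃ m₀ : ℕ, 0 < K ∧ 1 ≤ m₀ ∧ ∀ m : ℕ, m₀ ≤ m →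
      ∫ t in (2 * π * (m : ℝ) ^ 2)..(2 * π * ((m : ℝ) + 1) ^ 2), ‖riemannZeta (1 / 2 + t * I)‖ ^ 2 ≤
        K * ((m : ℝ) + 1) * (1 + Real.log ((m : ℝ) + 1)) ^ 2 := by
  obtain ⟨C₀, t₀, hAFE⟩ := Bourgain2017_eq43_holds
  -- `m₀` with `2π m₀² ≥ t₀`
  obtain ⟨m₀, hm₀⟩ : ∃ m₀ : ℕ, 1 ≤ m₀ ∧ t₀ ≤ 2 * π * (m₀ : ℝ) ^ 2 := by
    obtain ⟨k, hk⟩ := exists_nat_ge (max t₀ 1)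
    refine ⟨max k 1, le_max_right _ _, ?_⟩
    have hk1 : (1 : ℝ) ≤ (max k 1 : ℕ) := by exact_mod_cast le_max_right k 1
    have hkk : (k : ℝ) ≤ (max k 1 : ℕ) := by exact_mod_cast le_max_left k 1
    have hπ := Real.pi_gt_three
    calc t₀ ≤ max t₀ 1 := le_max_left _ _
      _ ≤ k := hk
      _ ≤ (max k 1 : ℕ) := hkk
      _ ≤ 2 * π * ((max k 1 : ℕ) : ℝ) ^ 2 := by nlinarith
  refine ⟨800 * (1 + C₀ ^ 2), m₀, by positivity, hm₀.1, fun m hm ↦ ?_⟩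
  have hπ := Real.pi_pos
  have hπ3 := Real.pi_gt_three
  have hm1 : (1 : ℝ) ≤ m := by exact_mod_cast hm₀.1.trans hm
  set a : ℝ := 2 * π * (m : ℝ) ^ 2 with ha
  set b : ℝ := 2 * π * ((m : ℝ) + 1) ^ 2 with hb
  have hab : a ≤ b := by rw [ha, hb]; nlinarith
  have hat₀ : t₀ ≤ a := by
    have : (m₀ : ℝ) ^ 2 ≤ (m : ℝ) ^ 2 := by
      have : (m₀ : ℝ) ≤ m := by exact_mod_cast hm
      nlinarith
    rw [ha]; nlinarith [hm₀.2]
  -- the two AFE sums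
  set S : ℕ → ℝ → ℂ := fun k t ↦ ∑ n ∈ Finset.Icc 1 k, (n : ℂ) ^ (-(1 / 2 : ℂ) + t * I) with hS
  -- pointwise: `‖ζ‖² ≤ 12‖S m‖² + 12‖S (m+1)‖² + 3C₀²` on `[a, b]`
  have hpt : ∀ t ∈ Icc a b, ‖riemannZeta (1 / 2 + t * I)‖ ^ 2 ≤
      12 * ‖S m t‖ ^ 2 + 12 * ‖S (m + 1) t‖ ^ 2 + 3 * C₀ ^ 2 := by
    intro t ht
    have ht0 : t₀ ≤ t := hat₀.trans ht.1
    have htpos : 0 ≤ t := by rw [ha] at ht; nlinarith [ht.1]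
    have h := hAFE t ht0
    -- the length of the sum is `m` or `m + 1`
    have hx : Real.sqrt (t / (2 * π)) ∈ Icc (m : ℝ) ((m : ℝ) + 1) := by
      constructor
      · rw [Real.le_sqrt (by positivity) (by positivity), le_div_iff₀ (by positivity)]
        rw [ha] at ht; nlinarith [ht.1]
      · rw [Real.sqrt_le_left (by positivity), div_le_iff₀ (by positivity)]
        rw [hb] at ht; nlinarith [ht.2]
    have hfl : ⌊Real.sqrt (t / (2 * π))⌋₊ = m ∨ ⌊Real.sqrt (t / (2 * π))⌋₊ = m + 1 := by
      rcases eq_or_lt_of_le hx.2 with heq | hlt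
      · right; rw [heq]; exact_mod_cast Nat.floor_natCast (m + 1)
      · left; exact (Nat.floor_eq_iff (Real.sqrt_nonneg _)).2 ⟨hx.1, hlt⟩
    have hbound : ‖riemannZeta (1 / 2 + t * I)‖ ≤ 2 * (‖S m t‖ + ‖S (m + 1) t‖) + |C₀| := by
      have h0 : 0 ≤ ‖S m t‖ := norm_nonneg _
      have h1 : 0 ≤ ‖S (m + 1) t‖ := norm_nonneg _
      rcases hfl with e | e <;> rw [e] at h <;> simp only [hS] <;> linarith [le_abs_self C₀]
    have h0 : 0 ≤ ‖S m t‖ := norm_nonneg _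
    have h1 : 0 ≤ ‖S (m + 1) t‖ := norm_nonneg _
    have h2 : 0 ≤ |C₀| := abs_nonneg _
    have hz : 0 ≤ ‖riemannZeta (1 / 2 + t * I)‖ := norm_nonneg _
    calc ‖riemannZeta (1 / 2 + t * I)‖ ^ 2 ≤ (2 * (‖S m t‖ + ‖S (m + 1) t‖) + |C₀|) ^ 2 :=
          pow_le_pow_left₀ hz hbound 2
      _ ≤ 12 * ‖S m t‖ ^ 2 + 12 * ‖S (m + 1) t‖ ^ 2 + 3 * C₀ ^ 2 := by
          nlinarith [sq_nonneg (‖S m t‖ - ‖S (m + 1) t‖), sq_nonneg (2 * ‖S m t‖ - |C₀|),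
            sq_nonneg (2 * ‖S (m + 1) t‖ - |C₀|), sq_abs C₀]
  -- integrate
  have hcont : ∀ k : ℕ, Continuous fun t : ℝ ↦ ‖S k t‖ ^ 2 := by
    intro k
    rw [hS]
    refine ((continuous_finsetSum _ fun n hn ↦ ?_).norm).pow 2
    have hn0 : (n : ℂ) ≠ 0 := by
      have : 1 ≤ n := (Finset.mem_Icc.1 hn).1
      exact_mod_cast (by omega : n ≠ 0)
    exact Continuous.const_cpow (by fun_prop) (Or.inl hn0)
  have hζc : Continuous fun t : ℝ ↦ ‖riemannZeta (1 / 2 + t * I)‖ ^ 2 := by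
    have hc : ContinuousOn riemannZeta {1}ᶜ := fun s hs ↦
      (differentiableAt_riemannZeta hs).continuousAt.continuousWithinAt
    refine ((hc.comp_continuous (by fun_prop) fun t h ↦ ?_).norm).pow 2
    have := congrArg Complex.re (h : (1 / 2 : ℂ) + t * I = 1)
    norm_num at this
  have hi1 : IntervalIntegrable (fun t : ℝ ↦ 12 * ‖S m t‖ ^ 2) volume a b :=
    ((hcont m).const_mul 12).intervalIntegrable (μ := volume) _ _
  have hi2 : IntervalIntegrable (fun t : ℝ ↦ 12 * ‖S (m + 1) t‖ ^ 2) volume a b :=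
    ((hcont (m + 1)).const_mul 12).intervalIntegrable (μ := volume) _ _
  have hi12 : IntervalIntegrable (fun t : ℝ ↦ 12 * ‖S m t‖ ^ 2 + 12 * ‖S (m + 1) t‖ ^ 2) volume a b :=
    hi1.add hi2
  have hi3 : IntervalIntegrable (fun _ : ℝ ↦ 3 * C₀ ^ 2) volume a b :=
    continuous_const.intervalIntegrable (μ := volume) _ _
  have hig : IntervalIntegrable (fun t : ℝ ↦ 12 * ‖S m t‖ ^ 2 + 12 * ‖S (m + 1) t‖ ^ 2 + 3 * C₀ ^ 2)
      volume a b := hi12.add hi3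
  have hmono := intervalIntegral.integral_mono_on hab (hζc.intervalIntegrable (μ := volume) _ _)
    hig hpt
  have hI1 := integral_norm_sq_afeSum_le hab (hm₀.1.trans hm)
  have hI2 := integral_norm_sq_afeSum_le hab (m := m + 1) (by omega)
  rw [intervalIntegral.integral_add hi12 hi3, intervalIntegral.integral_add hi1 hi2,
    intervalIntegral.integral_const_mul, intervalIntegral.integral_const_mul,
    intervalIntegral.integral_const] at hmono
  simp only [hS] at hmono
  -- bookkeeping: `b − a = 2π(2m+1)`, `log m ≤ log(m+1)`, `m ≤ m+1`
  have hba : b - a = 2 * π * (2 * m + 1) := by rw [ha, hb]; ring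
  have hlm : Real.log m ≤ Real.log ((m : ℝ) + 1) := Real.log_le_log (by linarith) (by linarith)
  have hlm0 : 0 ≤ Real.log (m : ℝ) := Real.log_nonneg hm1
  have hl1 : 0 ≤ Real.log ((m : ℝ) + 1) := Real.log_nonneg (by linarith)
  push_cast at hI2
  rw [hba] at hI1 hI2 hmono
  set L : ℝ := Real.log ((m : ℝ) + 1) with hL
  have hI1' : ∫ x in a..b, ‖∑ n ∈ Finset.Icc 1 m, (n : ℂ) ^ (-(1 / 2 : ℂ) + x * I)‖ ^ 2 ≤
      (2 * π * (2 * m + 1) + 8 * ((m : ℝ) + 1) * (1 + L)) * (1 + L) := by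
    refine hI1.trans ?_
    have h3 : (2 * π * (2 * m + 1) + 8 * (m : ℝ) * (1 + Real.log m)) ≤
        (2 * π * (2 * m + 1) + 8 * ((m : ℝ) + 1) * (1 + L)) := by nlinarith
    exact mul_le_mul h3 (by linarith) (by positivity) (by positivity)
  have hm2 : (2 : ℝ) * m + 1 ≤ 3 * ((m : ℝ) + 1) := by linarith
  have hπ4 : π ≤ 4 := by linarith [Real.pi_lt_d2]
  have hm0 : (0 : ℝ) ≤ (m : ℝ) + 1 := by positivity
  -- `B ≤ 32 (m+1)(1+L)²`
  have hB : (2 * π * (2 * m + 1) + 8 * ((m : ℝ) + 1) * (1 + L)) * (1 + L) ≤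
      32 * ((m : ℝ) + 1) * (1 + L) ^ 2 := by
    have h1 : 2 * π * (2 * m + 1) ≤ 24 * ((m : ℝ) + 1) := by nlinarith
    have h2 : 24 * ((m : ℝ) + 1) ≤ 24 * ((m : ℝ) + 1) * (1 + L) := by nlinarith
    have h3 : 2 * π * (2 * m + 1) + 8 * ((m : ℝ) + 1) * (1 + L) ≤ 32 * ((m : ℝ) + 1) * (1 + L) := by
      linarith
    calc (2 * π * (2 * m + 1) + 8 * ((m : ℝ) + 1) * (1 + L)) * (1 + L)
        ≤ (32 * ((m : ℝ) + 1) * (1 + L)) * (1 + L) := mul_le_mul_of_nonneg_right h3 (by linarith)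
      _ = 32 * ((m : ℝ) + 1) * (1 + L) ^ 2 := by ring
  set P : ℝ := ((m : ℝ) + 1) * (1 + L) ^ 2 with hP
  have hP0 : 0 ≤ P := by positivity
  have hP1 : ((m : ℝ) + 1) ≤ P := by
    have : 1 ≤ (1 + L) ^ 2 := by nlinarith
    calc ((m : ℝ) + 1) = ((m : ℝ) + 1) * 1 := (mul_one _).symm
      _ ≤ ((m : ℝ) + 1) * (1 + L) ^ 2 := mul_le_mul_of_nonneg_left this hm0
  have hC : (2 * π * (2 * (m : ℝ) + 1)) • (3 * C₀ ^ 2) ≤ 72 * (P * C₀ ^ 2) := by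
    rw [smul_eq_mul]
    have h1 : 2 * π * (2 * m + 1) * 3 ≤ 72 * ((m : ℝ) + 1) := by nlinarith
    have h1' : 2 * π * (2 * m + 1) * 3 ≤ 72 * P := by linarith
    calc 2 * π * (2 * (m : ℝ) + 1) * (3 * C₀ ^ 2) = (2 * π * (2 * m + 1) * 3) * C₀ ^ 2 := by ring
      _ ≤ (72 * P) * C₀ ^ 2 := mul_le_mul_of_nonneg_right h1' (sq_nonneg _)
      _ = 72 * (P * C₀ ^ 2) := by ring
  refine hmono.trans ?_
  have h32 : 32 * ((m : ℝ) + 1) * (1 + L) ^ 2 = 32 * P := by rw [hP]; ring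
  have hX : ∫ x in a..b, ‖∑ n ∈ Finset.Icc 1 m, (n : ℂ) ^ (-(1 / 2 : ℂ) + x * I)‖ ^ 2 ≤ 32 * P :=
    (hI1'.trans hB).trans_eq h32
  have hY : ∫ x in a..b, ‖∑ n ∈ Finset.Icc 1 (m + 1), (n : ℂ) ^ (-(1 / 2 : ℂ) + x * I)‖ ^ 2 ≤ 32 * P :=
    (hI2.trans hB).trans_eq h32
  have hgoal : 800 * (1 + C₀ ^ 2) * ((m : ℝ) + 1) * (1 + L) ^ 2 = 800 * P + 800 * (P * C₀ ^ 2) := by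
    rw [hP]; ring
  rw [hgoal]
  have hPC : 0 ≤ P * C₀ ^ 2 := by positivity
  linarith

/-! ### Summing the blocks: `∫_0^T |ζ(1/2+it)|² dt/(1+|t|) ≪ log³ T` -/

/-- Continuity of `t ↦ |ζ(1/2+it)|²/(1+|t|)`. [folklore] -/
theorem continuous_norm_sq_zeta_half_div :
    Continuous fun t : ℝ ↦ ‖riemannZeta (1 / 2 + t * I)‖ ^ 2 / (1 + |t|) := by
  have hc : ContinuousOn riemannZeta {1}ᶜ := fun s hs ↦
    (differentiableAt_riemannZeta hs).continuousAt.continuousWithinAt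
  have hζ : Continuous fun t : ℝ ↦ riemannZeta (1 / 2 + t * I) := by
    refine hc.comp_continuous (by fun_prop) fun t h ↦ ?_
    have := congrArg Complex.re (h : (1 / 2 : ℂ) + t * I = 1)
    norm_num at this
  exact (hζ.norm.pow 2).div (by fun_prop) fun t ↦ by positivity

/-- `‖ζ(1/2 − it)‖ = ‖ζ(1/2 + it)‖` (`ζ(s̄) = conj ζ(s)`), so the integrand is even. [folklore] -/
theorem norm_sq_zeta_half_div_neg (t : ℝ) :
    ‖riemannZeta (1 / 2 + ((-t : ℝ) : ℂ) * I)‖ ^ 2 / (1 + |-t|) =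
      ‖riemannZeta (1 / 2 + t * I)‖ ^ 2 / (1 + |t|) := by
  have h : (1 / 2 : ℂ) + ((-t : ℝ) : ℂ) * I = starRingEnd ℂ ((1 / 2 : ℂ) + t * I) := by
    apply Complex.ext <;> simp
  rw [h, riemannZeta_conj, Complex.norm_conj, abs_neg]

/-- **Weighted mean square, one-sided**: there is `C` with
`∫_0^T |ζ(1/2+it)|² dt/(1+|t|) ≤ C (1 + log T)³` for all `T ≥ 1`. [cite: Titchmarsh1986, Thm. 7.3 (weak form)] -/
theorem exists_integral_norm_sq_zeta_half_div_le :
    ∃ C : ℝ, 0 < C ∧ ∀ T : ℝ, 1 ≤ T →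
      ∫ t in (0 : ℝ)..T, ‖riemannZeta (1 / 2 + t * I)‖ ^ 2 / (1 + |t|) ≤ C * (1 + Real.log T) ^ 3 := by
  obtain ⟨K, m₀, hK, hm₀, hblock⟩ := norm_sq_zeta_half_block_le
  set f : ℝ → ℝ := fun t ↦ ‖riemannZeta (1 / 2 + t * I)‖ ^ 2 / (1 + |t|) with hf
  have hfc : Continuous f := continuous_norm_sq_zeta_half_div
  have hf0 : ∀ t, 0 ≤ f t := fun t ↦ by rw [hf]; positivity
  have hπ := Real.pi_pos
  have hπ3 := Real.pi_gt_three
  -- the blocks `a k = 2π (m₀ + k)²`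
  set a : ℕ → ℝ := fun k ↦ 2 * π * ((m₀ : ℝ) + k) ^ 2 with ha
  set A : ℝ := ∫ t in (0 : ℝ)..a 0, f t with hA
  have hA0 : 0 ≤ A := intervalIntegral.integral_nonneg (by rw [ha]; positivity) fun t _ ↦ hf0 t
  set B : ℝ := 1 + Real.log (2 + (m₀ : ℝ)) with hB
  have hB1 : 1 ≤ B := by
    have : 0 ≤ Real.log (2 + (m₀ : ℝ)) := Real.log_nonneg (by linarith [m₀.cast_nonneg (α := ℝ)])
    rw [hB]; linarith
  refine ⟨A + 2 * K * B ^ 3, by positivity, fun T hT ↦ ?_⟩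
  -- each block
  have hblk : ∀ k : ℕ, ∫ t in a k..a (k + 1), f t ≤
      2 * K * (1 + Real.log ((m₀ : ℝ) + k + 1)) ^ 2 / ((m₀ : ℝ) + k + 1) := by
    intro k
    set m : ℕ := m₀ + k with hm
    have hmR : (m : ℝ) = (m₀ : ℝ) + k := by rw [hm]; push_cast; ring
    have hak : a k = 2 * π * (m : ℝ) ^ 2 := by rw [ha, hmR]
    have hak1 : a (k + 1) = 2 * π * ((m : ℝ) + 1) ^ 2 := by rw [ha, hmR]; push_cast; ring
    have hle : a k ≤ a (k + 1) := by rw [hak, hak1]; nlinarith [(m : ℕ).cast_nonneg (α := ℝ)]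
    have hm1 : m₀ ≤ m := by omega
    have hbl := hblock m hm1
    have hm0 : (0 : ℝ) ≤ m := (m : ℕ).cast_nonneg
    -- pointwise `f t ≤ ‖ζ‖²/(1 + a k)` on the block
    have hpt : ∀ t ∈ Icc (a k) (a (k + 1)), f t ≤
        (1 + a k)⁻¹ * ‖riemannZeta (1 / 2 + t * I)‖ ^ 2 := by
      intro t ht
      have hak0 : 0 ≤ a k := by rw [hak]; positivity
      have ht0 : 0 ≤ t := hak0.trans ht.1
      rw [hf]; simp only
      rw [abs_of_nonneg ht0, div_eq_inv_mul]
      exact mul_le_mul_of_nonneg_right (inv_anti₀ (by positivity) (by linarith [ht.1]))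
        (sq_nonneg _)
    have hζc : Continuous fun t : ℝ ↦ ‖riemannZeta (1 / 2 + t * I)‖ ^ 2 := by
      have := continuous_norm_sq_zeta_half_div
      have e : (fun t : ℝ ↦ ‖riemannZeta (1 / 2 + t * I)‖ ^ 2) =
          fun t : ℝ ↦ ‖riemannZeta (1 / 2 + t * I)‖ ^ 2 / (1 + |t|) * (1 + |t|) := by
        funext t
        have : (0 : ℝ) < 1 + |t| := by positivity
        field_simp
      rw [e]; exact this.mul (by fun_prop)
    have hmono := intervalIntegral.integral_mono_on hle (hfc.intervalIntegrable (μ := volume) _ _)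
      ((hζc.const_mul _).intervalIntegrable (μ := volume) _ _) hpt
    rw [intervalIntegral.integral_const_mul] at hmono
    rw [hak, hak1] at hmono ⊢
    refine hmono.trans ?_
    have hden : ((m : ℝ) + 1) ^ 2 ≤ 2 * (1 + 2 * π * (m : ℝ) ^ 2) := by
      have h2m : 2 * (m : ℝ) ≤ (m : ℝ) ^ 2 + 1 := by nlinarith [sq_nonneg ((m : ℝ) - 1)]
      nlinarith
    have hpos : 0 < 1 + 2 * π * (m : ℝ) ^ 2 := by positivity
    have hl0 : 0 ≤ (1 + Real.log ((m : ℝ) + 1)) ^ 2 := sq_nonneg _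
    rw [← hmR]
    rw [inv_mul_le_iff₀ hpos, div_eq_mul_inv]
    calc ∫ x in (2 * π * (m : ℝ) ^ 2)..(2 * π * ((m : ℝ) + 1) ^ 2), ‖riemannZeta (1 / 2 + x * I)‖ ^ 2
        ≤ K * ((m : ℝ) + 1) * (1 + Real.log ((m : ℝ) + 1)) ^ 2 := hbl
      _ = (K * (1 + Real.log ((m : ℝ) + 1)) ^ 2) * ((m : ℝ) + 1) := by ring
      _ ≤ (K * (1 + Real.log ((m : ℝ) + 1)) ^ 2) * (2 * (1 + 2 * π * (m : ℝ) ^ 2) * ((m : ℝ) + 1)⁻¹) := by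
          refine mul_le_mul_of_nonneg_left ?_ (by positivity)
          rw [le_mul_inv_iff₀ (by positivity)]
          nlinarith
      _ = (1 + 2 * π * (m : ℝ) ^ 2) * (2 * K * (1 + Real.log ((m : ℝ) + 1)) ^ 2 * ((m : ℝ) + 1)⁻¹) := by
          ring
  -- the number of blocks
  obtain ⟨n, hn⟩ : ∃ n : ℕ, T ≤ a n ∧ ((m₀ : ℝ) + n) ≤ (2 + m₀) * T := by
    refine ⟨⌈T⌉₊, ?_, ?_⟩
    · have h1 : T ≤ (⌈T⌉₊ : ℝ) := Nat.le_ceil T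
      have h2 : (0 : ℝ) ≤ m₀ := m₀.cast_nonneg
      rw [ha]; simp only
      nlinarith
    · have h1 : (⌈T⌉₊ : ℝ) ≤ T + 1 := (Nat.ceil_lt_add_one (by linarith)).le
      have h2 : (0 : ℝ) ≤ m₀ := m₀.cast_nonneg
      nlinarith
  -- `∫_0^T ≤ ∫_0^{a n} = A + Σ blocks`
  have hsum := intervalIntegral.sum_integral_adjacent_intervals (μ := volume) (f := f) (a := a)
    (n := n) fun k _ ↦ hfc.intervalIntegrable (μ := volume) _ _
  have ha00 : 0 ≤ a 0 := by rw [ha]; positivity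
  have hstep1 : ∫ t in (0 : ℝ)..T, f t ≤ ∫ t in (0 : ℝ)..a n, f t :=
    intervalIntegral.integral_mono_interval le_rfl (by linarith) hn.1
      (Eventually.of_forall fun t ↦ hf0 t) (hfc.intervalIntegrable (μ := volume) _ _)
  have hsplit : ∫ t in (0 : ℝ)..a n, f t = A + ∑ k ∈ Finset.range n, ∫ t in a k..a (k + 1), f t := by
    rw [hsum, hA]
    exact (intervalIntegral.integral_add_adjacent_intervals (hfc.intervalIntegrable (μ := volume) _ _)
      (hfc.intervalIntegrable (μ := volume) _ _)).symm
  -- bound the sum of the blocks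
  set N' : ℝ := (m₀ : ℝ) + n with hN'
  have hN'1 : 1 ≤ N' := by
    have : (1 : ℝ) ≤ m₀ := by exact_mod_cast hm₀
    have h2 : (0 : ℝ) ≤ n := n.cast_nonneg
    rw [hN']; linarith
  have hlogN' : 0 ≤ Real.log N' := Real.log_nonneg hN'1
  have hterm : ∀ k ∈ Finset.range n, ∫ t in a k..a (k + 1), f t ≤
      2 * K * (1 + Real.log N') ^ 2 * ((m₀ : ℝ) + k + 1)⁻¹ := by
    intro k hk
    have hk' : (k : ℝ) + 1 ≤ n := by exact_mod_cast Finset.mem_range.1 hk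
    refine (hblk k).trans ?_
    rw [div_eq_mul_inv]
    have hkpos : 0 < (m₀ : ℝ) + k + 1 := by positivity
    have hlk : Real.log ((m₀ : ℝ) + k + 1) ≤ Real.log N' :=
      Real.log_le_log hkpos (by rw [hN']; linarith)
    have hlk0 : 0 ≤ Real.log ((m₀ : ℝ) + k + 1) := Real.log_nonneg (by linarith [m₀.cast_nonneg (α := ℝ)])
    gcongr
  have hharm : ∑ k ∈ Finset.range n, ((m₀ : ℝ) + k + 1)⁻¹ ≤ 1 + Real.log N' := by
    -- compare with the harmonic sum over `range (m₀ + n)`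
    have h1 : ∑ k ∈ Finset.range n, ((m₀ : ℝ) + k + 1)⁻¹ ≤
        ∑ j ∈ Finset.range (m₀ + n), ((j : ℝ) + 1)⁻¹ := by
      have e : ∑ k ∈ Finset.range n, ((m₀ : ℝ) + k + 1)⁻¹ =
          ∑ j ∈ Finset.Ico m₀ (m₀ + n), ((j : ℝ) + 1)⁻¹ := by
        rw [Finset.sum_Ico_eq_sum_range]
        simp only [Nat.add_sub_cancel_left]
        refine Finset.sum_congr rfl fun k _ ↦ ?_
        push_cast; ring
      rw [e]
      exact Finset.sum_le_sum_of_subset_of_nonneg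
        (fun j hj ↦ Finset.mem_range.2 (Finset.mem_Ico.1 hj).2) fun j _ _ ↦ by positivity
    have h2 := harmonic_le_one_add_log (m₀ + n)
    rw [harmonic] at h2
    push_cast at h2
    rw [← hN'] at h2
    exact h1.trans h2
  have hsumle : ∑ k ∈ Finset.range n, ∫ t in a k..a (k + 1), f t ≤ 2 * K * (1 + Real.log N') ^ 3 := by
    calc ∑ k ∈ Finset.range n, ∫ t in a k..a (k + 1), f t
        ≤ ∑ k ∈ Finset.range n, 2 * K * (1 + Real.log N') ^ 2 * ((m₀ : ℝ) + k + 1)⁻¹ :=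
          Finset.sum_le_sum hterm
      _ = 2 * K * (1 + Real.log N') ^ 2 * ∑ k ∈ Finset.range n, ((m₀ : ℝ) + k + 1)⁻¹ := by
          rw [Finset.mul_sum]
      _ ≤ 2 * K * (1 + Real.log N') ^ 2 * (1 + Real.log N') :=
          mul_le_mul_of_nonneg_left hharm (by positivity)
      _ = 2 * K * (1 + Real.log N') ^ 3 := by ring
  -- `1 + log N' ≤ B (1 + log T)`
  have hlogT : 0 ≤ Real.log T := Real.log_nonneg hT
  have hNB : 1 + Real.log N' ≤ B * (1 + Real.log T) := by
    have h1 : Real.log N' ≤ Real.log (2 + (m₀ : ℝ)) + Real.log T := by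
      rw [← Real.log_mul (by positivity) (by linarith)]
      exact Real.log_le_log (by linarith) hn.2
    have h2 : 0 ≤ Real.log (2 + (m₀ : ℝ)) := Real.log_nonneg (by linarith [m₀.cast_nonneg (α := ℝ)])
    rw [hB]; nlinarith
  have hcube : (1 + Real.log N') ^ 3 ≤ B ^ 3 * (1 + Real.log T) ^ 3 := by
    rw [← mul_pow]
    exact pow_le_pow_left₀ (by linarith) hNB 3
  have h1T : 1 ≤ (1 + Real.log T) ^ 3 := one_le_pow₀ (by linarith)
  calc ∫ t in (0 : ℝ)..T, f t ≤ ∫ t in (0 : ℝ)..a n, f t := hstep1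
    _ = A + ∑ k ∈ Finset.range n, ∫ t in a k..a (k + 1), f t := hsplit
    _ ≤ A + 2 * K * (1 + Real.log N') ^ 3 := by linarith
    _ ≤ A * (1 + Real.log T) ^ 3 + 2 * K * (B ^ 3 * (1 + Real.log T) ^ 3) := by
        have : A ≤ A * (1 + Real.log T) ^ 3 := le_mul_of_one_le_right hA0 h1T
        nlinarith
    _ = (A + 2 * K * B ^ 3) * (1 + Real.log T) ^ 3 := by ring

/-- **Weighted mean square, symmetric form**: there is `C` with
`∫_{-T}^{T} |ζ(1/2+it)|² dt/(1+|t|) ≤ C (1 + log T)³` for all `T ≥ 1`.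
[cite: Titchmarsh1986, Thm. 7.3 (weak form)] -/
theorem exists_integral_norm_sq_zeta_half_div_le_symm :
    ∃ C : ℝ, 0 < C ∧ ∀ T : ℝ, 1 ≤ T →
      ∫ t in (-T)..T, ‖riemannZeta (1 / 2 + t * I)‖ ^ 2 / (1 + |t|) ≤ C * (1 + Real.log T) ^ 3 := by
  obtain ⟨C, hC, h⟩ := exists_integral_norm_sq_zeta_half_div_le
  refine ⟨2 * C, by positivity, fun T hT ↦ ?_⟩
  set f : ℝ → ℝ := fun t ↦ ‖riemannZeta (1 / 2 + t * I)‖ ^ 2 / (1 + |t|) with hf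
  have hfc : Continuous f := continuous_norm_sq_zeta_half_div
  have hsplit : ∫ t in (-T)..T, f t = (∫ t in (-T)..0, f t) + ∫ t in (0 : ℝ)..T, f t :=
    (intervalIntegral.integral_add_adjacent_intervals (hfc.intervalIntegrable (μ := volume) _ _)
      (hfc.intervalIntegrable (μ := volume) _ _)).symm
  have hneg : ∫ t in (-T)..0, f t = ∫ t in (0 : ℝ)..T, f t := by
    have h1 := intervalIntegral.integral_comp_neg (a := 0) (b := T) (f := f)
    simp only [neg_zero] at h1
    rw [← h1]
    refine intervalIntegral.integral_congr fun t _ ↦ ?_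
    rw [hf]
    exact norm_sq_zeta_half_div_neg t
  rw [hsplit, hneg]
  have := h T hT
  linarith

end Literature.NumberTheory.LFunctions

end
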